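import Summits.AtomisticToContinuum.Crystallization.Theses.NashClassCertificates
import Summits.AtomisticToContinuum.Crystallization.Theorems.LayeredLawsSelectHcp.Negative.FccEnergy
import Summits.AtomisticToContinuum.Crystallization.Theorems.PhononSlackCertificatesNearFarGlueRLatticeShell

/-!
# Crux `NashTwoShellGap` (stmt-AtomisticToContinuum-16826), line `bulk_dilute`:
# host-referenced site sums on the fcc lattice (Kossel corner)

Registered stub `stub_fccSiteSums` of the lead's skeleton (line `bulk_dilute`, the ON-LATTICE
corner).  For an injective configuration `x` supported on the fcc lattice `fccD3 a`
(`a ∈ [47/50, 1]`, tree: `LayeredLawsSelectHcp.Negative.FccLattice.fccD3`), the site energy of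
every particle is compared with the full lattice sum
`L(a) := ∑_{0 ≠ y ∈ fccD3 a} V_LJ(‖y‖) = 2 · e(fccPC a)` (`FccEnergy.energyPerParticle_fccPC`):

* `L(a) ≤ Σ_{k ≠ i} V_LJ(|x_i − x_k|)` — the site sum is the sum of `V_LJ(‖y‖)` over the finite
  subset `{x_k − x_i : k ≠ i}` of the non-zero lattice vectors, and every other term of the
  absolutely convergent lattice sum is `≤ 0` (non-zero lattice vectors have norm `≥ a ≥ 47/50`,
  where `V_LJ ≤ 0`);
* if some two-shell site `x_i + a • v`, `v ∈ fccTwoShellPattern`, is vacant, then moreover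
  `L(a) + 15/768 ≤ Σ_{k ≠ i} V_LJ(|x_i − x_k|)`: the vacant site is one more non-positive term,
  worth `V_LJ(a) ≤ −0.066` or `V_LJ(√2·a) ≤ V_LJ(√2) = −15/768`.

The Lennard-Jones value lemmas (`lennardJones_nonpos_of_ge`, `lennardJones_site_le`) and the
two-shell bookkeeping (`smul_patternPt`, `site_ne_zero`, `even_of_mem_twoShellInt`) are those of the
tree file `PhononSlackCertificatesNearFarGlueRLatticeShell`.  No definitions; `[folklore]`.
-/

noncomputable section

namespace Summit.AtomisticToContinuum.Crystallization.Theorems.NashTwoShellGapFccSiteSums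

open scoped BigOperators
open Literature.MathematicalPhysics.StatisticalMechanics Literature.Geometry.DiscreteGeometry
open Summit.AtomisticToContinuum.Crystallization.Theorems.LayeredLawsSelectHcp.Negative.FccLattice
  (fccD3 le_dist_of_mem_fccD3)
open Summit.AtomisticToContinuum.Crystallization.Theorems.LayeredLawsSelectHcp.Negative.FccEnergy
  (fccPC energyPerParticle_fccPC summable_abs_lennardJones_fccD3)
open Summit.AtomisticToContinuum.Crystallization.Theorems.PhononSlackCertificatesNearFarGlueR
  (lennardJones_nonpos_of_ge lennardJones_site_le smul_patternPt site_ne_zero even_of_mem_twoShellInt)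

/-! ## §1 Two-shell sites are non-zero lattice vectors worth at least `15/768` -/

/-- **A two-shell site is a non-zero lattice vector worth at least `15/768`**: for
`v ∈ fccTwoShellPattern` and `a ∈ [47/50, 1]`, `a • v ∈ fccD3 a`, `a • v ≠ 0` and
`V_LJ(‖a • v‖) ≤ −15/768` (`‖a • v‖ = a` or `√2·a`). [folklore] -/
theorem smul_site_of_mem_fccTwoShellPattern {a : ℝ} (h47 : 47 / 50 ≤ a) (h1 : a ≤ 1)
    {v : EuclideanSpace ℝ (Fin 3)} (hv : v ∈ fccTwoShellPattern) :
    a • v ∈ (fccD3 a : Set (EuclideanSpace ℝ (Fin 3))) ∧ a • v ≠ 0 ∧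
      lennardJones ‖a • v‖ ≤ -(15 / 768) := by
  have ha0 : 0 < a := by linarith
  obtain ⟨u, hu, rfl⟩ := Finset.mem_image.1 hv
  rw [smul_patternPt a u]
  exact ⟨⟨u, even_of_mem_twoShellInt hu, rfl⟩, site_ne_zero ha0 hu, lennardJones_site_le h47 h1 hu⟩

/-! ## §2 The site sum as a finite part of the lattice sum -/

/-- **The occupied relative positions carry the site energy**: the vectors `x_k − x_i`, `k ≠ i`,
form a finite set `S` of non-zero vectors of `fccD3 a` with
`∑_{y ∈ S} V_LJ(‖y‖) = Σ_{k ≠ i} V_LJ(|x_i − x_k|)` (injectivity of `x`). [folklore] -/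
theorem exists_finset_sum_eq_siteEnergy {a : ℝ} {N : ℕ} {x : Fin N → EuclideanSpace ℝ (Fin 3)}
    (hx : Function.Injective x)
    (hL : ∀ j : Fin N, x j ∈ (fccD3 a : Set (EuclideanSpace ℝ (Fin 3)))) (i : Fin N) :
    ∃ S : Finset {y : EuclideanSpace ℝ (Fin 3) //
        y ∈ (fccD3 a : Set (EuclideanSpace ℝ (Fin 3))) ∧ y ≠ 0},
      (∑ y ∈ S, lennardJones ‖(y : EuclideanSpace ℝ (Fin 3))‖ = siteEnergy lennardJones x i) ∧
      ∀ y ∈ S, ∃ k : Fin N, k ≠ i ∧ (y : EuclideanSpace ℝ (Fin 3)) = x k - x i := by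
  classical
  let U : Finset (EuclideanSpace ℝ (Fin 3)) := (Finset.univ.erase i).image fun k => x k - x i
  have hUmem : ∀ z ∈ U, z ∈ (fccD3 a : Set (EuclideanSpace ℝ (Fin 3))) ∧ z ≠ 0 := by
    intro z hz
    obtain ⟨k, hk, rfl⟩ := Finset.mem_image.1 hz
    exact ⟨(fccD3 a).sub_mem (hL k) (hL i),
      sub_ne_zero.2 fun h => Finset.ne_of_mem_erase hk (hx h)⟩
  refine ⟨U.subtype fun y => y ∈ (fccD3 a : Set (EuclideanSpace ℝ (Fin 3))) ∧ y ≠ 0, ?_, ?_⟩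
  · have hsub : ∑ y ∈ U.subtype (fun y => y ∈ (fccD3 a : Set (EuclideanSpace ℝ (Fin 3))) ∧ y ≠ 0),
        lennardJones ‖(y : EuclideanSpace ℝ (Fin 3))‖ = ∑ z ∈ U, lennardJones ‖z‖ :=
      Finset.sum_subtype_of_mem (fun z : EuclideanSpace ℝ (Fin 3) => lennardJones ‖z‖) hUmem
    have hinj : ∀ k ∈ Finset.univ.erase i, ∀ k' ∈ Finset.univ.erase i,
        x k - x i = x k' - x i → k = k' :=
      fun k _ k' _ h => hx (sub_left_inj.mp h)
    rw [hsub, Finset.sum_image hinj]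
    unfold siteEnergy
    refine Finset.sum_congr rfl fun k _ => ?_
    rw [dist_comm, dist_eq_norm]
  · intro y hy
    rw [Finset.mem_subtype] at hy
    obtain ⟨k, hk, hk'⟩ := Finset.mem_image.1 hy
    exact ⟨k, Finset.ne_of_mem_erase hk, hk'.symm⟩

/-! ## §3 The stub -/

/-- **Registered sub-goal `stub_fccSiteSums`** (lead, line `bulk_dilute`, Kossel corner): on an
injective configuration supported on `fccD3 a`, `a ∈ [47/50, 1]`, every site sum dominates the
lattice sum `2·e(fccPC a) = ∑_{0 ≠ y ∈ fccD3 a} V_LJ(‖y‖)` (split the absolutely convergent lattice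
sum over the finite set of occupied relative positions and its complement, whose terms are `≤ 0`),
and exceeds it by `15/768` when a two-shell site `x_i + a • v` is vacant (one more non-positive
term, worth `≤ −15/768`). [folklore] -/
theorem stub_fccSiteSums : ∀ (a : ℝ) (ha : a ≠ 0), 47 / 50 ≤ a → a ≤ 1 → ∀ (N : ℕ) (x : Fin N → EuclideanSpace ℝ (Fin 3)), Function.Injective x → (∀ i : Fin N, x i ∈ (Summit.AtomisticToContinuum.Crystallization.Theorems.LayeredLawsSelectHcp.Negative.FccLattice.fccD3 a : Set (EuclideanSpace ℝ (Fin 3)))) → ∀ i : Fin N, 2 * (Summit.AtomisticToContinuum.Crystallization.Theorems.LayeredLawsSelectHcp.Negative.FccEnergy.fccPC ha).energyPerParticle Literature.MathematicalPhysics.StatisticalMechanics.lennardJones ≤ Literature.MathematicalPhysics.StatisticalMechanics.siteEnergy Literature.MathematicalPhysics.StatisticalMechanics.lennardJones x i ∧ ((∃ v ∈ Literature.Geometry.DiscreteGeometry.fccTwoShellPattern, ∀ j : Fin N, x j ≠ x i + a • v) → 2 * (Summit.AtomisticToContinuum.Crystallization.Theorems.LayeredLawsSelectHcp.Negative.FccEnergy.fccPC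 ha).energyPerParticle Literature.MathematicalPhysics.StatisticalMechanics.lennardJones + 15 / 768 ≤ Literature.MathematicalPhysics.StatisticalMechanics.siteEnergy Literature.MathematicalPhysics.StatisticalMechanics.lennardJones x i) := by
  intro a ha h47 h1 N x hx hL i
  classical
  have ha0 : 0 < a := by linarith
  -- the lattice sum, its convergence and the sign of its terms
  have hsum : Summable fun y : {y : EuclideanSpace ℝ (Fin 3) //
      y ∈ (fccD3 a : Set (EuclideanSpace ℝ (Fin 3))) ∧ y ≠ 0} =>
        lennardJones ‖(y : EuclideanSpace ℝ (Fin 3))‖ :=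
    (summable_abs_lennardJones_fccD3 ha).of_abs
  have h2e : 2 * (fccPC ha).energyPerParticle lennardJones =
      ∑' y : {y : EuclideanSpace ℝ (Fin 3) //
        y ∈ (fccD3 a : Set (EuclideanSpace ℝ (Fin 3))) ∧ y ≠ 0},
          lennardJones ‖(y : EuclideanSpace ℝ (Fin 3))‖ := by
    rw [energyPerParticle_fccPC ha lennardJones]; ring
  have hnonpos : ∀ y : {y : EuclideanSpace ℝ (Fin 3) //
      y ∈ (fccD3 a : Set (EuclideanSpace ℝ (Fin 3))) ∧ y ≠ 0},
        lennardJones ‖(y : EuclideanSpace ℝ (Fin 3))‖ ≤ 0 := fun y => by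
    have hd : a ≤ ‖(y : EuclideanSpace ℝ (Fin 3))‖ := by
      have := le_dist_of_mem_fccD3 ha0 y.2.1 (fccD3 a).zero_mem y.2.2
      rwa [dist_zero_right] at this
    exact lennardJones_nonpos_of_ge (h47.trans hd)
  -- the occupied relative positions
  obtain ⟨S, hS, hSmem⟩ := exists_finset_sum_eq_siteEnergy hx hL i
  rw [h2e]
  refine ⟨?_, ?_⟩
  · have hsplit := hsum.sum_add_tsum_compl (s := S)
    have htail : ∑' y : ↥((↑S : Set {y : EuclideanSpace ℝ (Fin 3) //
        y ∈ (fccD3 a : Set (EuclideanSpace ℝ (Fin 3))) ∧ y ≠ 0})ᶜ),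
          lennardJones ‖((y : {y : EuclideanSpace ℝ (Fin 3) //
            y ∈ (fccD3 a : Set (EuclideanSpace ℝ (Fin 3))) ∧ y ≠ 0}) : EuclideanSpace ℝ (Fin 3))‖
          ≤ 0 :=
      tsum_nonpos fun y => hnonpos y
    rw [← hsplit, hS]
    linarith
  · rintro ⟨v, hv, hvac⟩
    obtain ⟨hmem, hne, hval⟩ := smul_site_of_mem_fccTwoShellPattern h47 h1 hv
    let w : {y : EuclideanSpace ℝ (Fin 3) //
        y ∈ (fccD3 a : Set (EuclideanSpace ℝ (Fin 3))) ∧ y ≠ 0} := ⟨a • v, hmem, hne⟩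
    have hwS : w ∉ S := by
      intro h
      obtain ⟨k, hk, hk'⟩ := hSmem w h
      have hk'' : a • v = x k - x i := hk'
      exact hvac k (by rw [hk'']; abel)
    have hsplit := hsum.sum_add_tsum_compl (s := insert w S)
    have htail : ∑' y : ↥((↑(insert w S) : Set {y : EuclideanSpace ℝ (Fin 3) //
        y ∈ (fccD3 a : Set (EuclideanSpace ℝ (Fin 3))) ∧ y ≠ 0})ᶜ),
          lennardJones ‖((y : {y : EuclideanSpace ℝ (Fin 3) //
            y ∈ (fccD3 a : Set (EuclideanSpace ℝ (Fin 3))) ∧ y ≠ 0}) : EuclideanSpace ℝ (Fin 3))‖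
          ≤ 0 :=
      tsum_nonpos fun y => hnonpos y
    rw [Finset.sum_insert hwS] at hsplit
    have hw : lennardJones ‖((w : {y : EuclideanSpace ℝ (Fin 3) //
        y ∈ (fccD3 a : Set (EuclideanSpace ℝ (Fin 3))) ∧ y ≠ 0}) : EuclideanSpace ℝ (Fin 3))‖
          ≤ -(15 / 768) := hval
    rw [← hsplit, hS]
    linarith

end Summit.AtomisticToContinuum.Crystallization.Theorems.NashTwoShellGapFccSiteSums

end
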